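import Summits.HubbardSuperconductivity.HubbardSuperconductivity.Theorems.BalabanIRBirGroundStateAverageLRO
import Summits.HubbardSuperconductivity.HubbardSuperconductivity.Theorems.BalabanIRBirGappedPhaseReductionThermal
import Summits.HubbardSuperconductivity.HubbardSuperconductivity.Theorems.BalabanIRBirGroundStateAverageLROSoftminPeierls
import Summits.HubbardSuperconductivity.HubbardSuperconductivity.Theorems.BalabanIRBirGroundStateAverageLROStubSectorGibbsLogSum
import Summits.HubbardSuperconductivity.HubbardSuperconductivity.Theorems.BalabanIRBirGroundStateAverageLROStubSectorEnergyNonneg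
import Summits.HubbardSuperconductivity.HubbardSuperconductivity.Theorems.BalabanIRBirGroundStateAverageLROStubLogTraceSectorProjLe
import Summits.HubbardSuperconductivity.HubbardSuperconductivity.Theorems.BalabanIRBirGroundStateAverageLROStubSectorProjCommutePair
import Literature.MathematicalPhysics.QuantumLattice.FinDimSpectrumSectorGibbsLimit
import Literature.MathematicalPhysics.QuantumLattice.DuhamelTwoPoint
import Literature.MathematicalPhysics.QuantumLattice.BdGBondHamiltonianParticleHole

/-!
# Route BalabanIR — crux `BirGroundStateAverageLRO` (item `stmt-HubbardSuperconductivity-2079`), line `Sketch` (softmin-pair-penalty): the transfer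

The lever (★) of card `Cruxes/BirGroundStateAverageLRO/Ideas/softmin-pair-penalty.md`, proved:
for every normalised ground state `ψ` of `H = hubbardTorus 2 L 1 U` in the sector
`S = szSector N_L 0`, with `A = Δ_d†Δ_d` (`Δ_d = pairField dWaveFormFactor L`), penalty
`K = H + (κ/L⁴)A`, `β = θL²`, `e_S = minEnergyOn H S`, `P_S` the sector projection,

  `(κ/L⁴) Re⟨ψ, A ψ⟩ ≥ -(1/β) log Re tr (P_S e^{-β(K - e_S)}) ≥ (κ/L⁴)⟨A⟩^S_{β,K} - log(Re tr P_S)/β`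

(`softmin_chain`: Peierls–Jensen for the vector state, `Softmin.softmin_le_expect`, then the Gibbs
variational principle in the sector, `Softmin.stub_sectorGibbsLogSum` + `Softmin.stub_sectorEnergyNonneg`).
With the entropy budget `log Re tr P_S ≤ L² log 4` (`Softmin.stub_logTraceSectorProjLe`) and
`θκx ≥ 4 log 4`, a thermal floor `⟨A⟩^S_{β_L,K} ≥ x L⁴` of the PENALISED torus at ONE inverse
temperature `β_L = θL²` gives `Re⟨ψ, A ψ⟩ ≥ (x/2) L⁴` for EVERY sector ground state
(`everyGroundState_of_floorAt`), hence the crux with `c = x/2` on the window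
(`stub_transferTower` = `transfer_tower`, through the landed glue `birGroundStateAverageLRO_of_forall_groundState`).

So the crux `BirGroundStateAverageLRO` is reduced to the single engine deliverable
C⁺ = "penalised thermal floor" (`stub_penalisedThermalFloor` of `Cruxes/…/Lines/Sketch.lean`):
one real-trace inequality for the canonical sector Gibbs state of the Hermitian penalised
Hamiltonian at one aspect ratio — no `β → ∞` uniformity, no spectral input, no genericity.

Sources: R. Peierls, Phys. Rev. 54 (1938) 918; Gibbs variational principle, O. Bratteli,
D. W. Robinson, *Operator Algebras and Quantum Statistical Mechanics II*, Prop. 6.2.22; B. Simon,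
*The Statistical Mechanics of Lattice Gases* I (1993) §I.8; H. Tasaki (2020) App. A. Folklore;
no definition is introduced.
-/

noncomputable section

namespace Summit.HubbardSuperconductivity.HubbardSuperconductivity.Theorems.BirGroundStateAverageLRO.Softmin

open Matrix Finset Filter Literature.MathematicalPhysics.QuantumLattice Literature.Probability.LatticeModels
open Summit.HubbardSuperconductivity.HubbardSuperconductivity.Theses.BalabanIR
open Summit.HubbardSuperconductivity.HubbardSuperconductivity.Theorems
open scoped ComplexOrder


/-! ## §1 The abstract softmin chain (finite-dimensional) -/

section Abstract

variable {n : Type*} [Fintype n] [DecidableEq n]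

/-- Shift of the Gibbs weight by a scalar: `e^{-β(K - e·1)} = e^{βe} · e^{-βK}`. [folklore] -/
theorem gibbsWeight_sub_smul_one (β e : ℝ) (K : Matrix n n ℂ) :
    gibbsWeight β (K - ((e : ℝ) : ℂ) • (1 : Matrix n n ℂ)) =
      ((Real.exp (β * e) : ℝ) : ℂ) • gibbsWeight β K := by
  rw [sub_eq_add_neg, ← neg_smul, gibbsWeight_add_smul_one]
  congr 1
  rw [Complex.ofReal_exp]
  congr 1
  push_cast
  ring

/-- **The abstract softmin chain** (lever (★) of the card, both inequalities): idempotent Hermitian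
`P` (a sector) commuting with Hermitian `H` and `A`; `e` the sector energy floor of `H`; `ψ` a unit
vector of the sector with `H ψ = e ψ`; `β, g > 0`; and the THERMAL FLOOR
`m · Re tr (P e^{-β(H + gA)}) ≤ Re tr (P e^{-β(H + gA)} A)` (sector Gibbs average of `A` in the
penalised state `≥ m`). Then `g·m - log(Re tr P)/β ≤ g · Re ⟨ψ, A ψ⟩`. [folklore] -/
theorem softmin_chain (P H A : Matrix n n ℂ) (hP : P * P = P) (hPh : P.IsHermitian)
    (hPH : Commute P H) (hPA : Commute P A) (hH : H.IsHermitian) (hA : A.IsHermitian)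
    {β g : ℝ} (hβ : 0 < β) (hg : 0 ≤ g) (m e : ℝ)
    (he : ∀ φ : n → ℂ, P *ᵥ φ = φ → star φ ⬝ᵥ φ = 1 → e ≤ (star φ ⬝ᵥ (H *ᵥ φ)).re)
    (ψ : n → ℂ) (hPψ : P *ᵥ ψ = ψ) (hψ : star ψ ⬝ᵥ ψ = 1) (hHψ : H *ᵥ ψ = ((e : ℝ) : ℂ) • ψ)
    (hfloor : m * (P * gibbsWeight β (H + ((g : ℝ) : ℂ) • A)).trace.re ≤
      (P * gibbsWeight β (H + ((g : ℝ) : ℂ) • A) * A).trace.re) :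
    g * m - Real.log (P.trace.re) / β ≤ g * (star ψ ⬝ᵥ (A *ᵥ ψ)).re := by
  -- notation
  set B : Matrix n n ℂ := ((g : ℝ) : ℂ) • A with hBdef
  set K : Matrix n n ℂ := H + B with hKdef
  set K' : Matrix n n ℂ := H - ((e : ℝ) : ℂ) • (1 : Matrix n n ℂ) + B with hK'def
  have hB : B.IsHermitian := by
    rw [hBdef]
    unfold Matrix.IsHermitian
    rw [conjTranspose_smul, hA.eq, Complex.star_def, Complex.conj_ofReal]
  have hPB : Commute P B := hPA.smul_right _
  have hK : K.IsHermitian := hH.add hB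
  have hK' : K'.IsHermitian := by
    rw [hK'def]
    refine IsHermitian.add (IsHermitian.sub hH ?_) hB
    unfold Matrix.IsHermitian
    rw [conjTranspose_smul, conjTranspose_one, Complex.star_def, Complex.conj_ofReal]
  have hPK' : Commute P K' := by
    rw [hK'def]
    exact (hPH.sub_right ((Commute.one_right P).smul_right _)).add_right hPB
  have hKK' : K' = K - ((e : ℝ) : ℂ) • (1 : Matrix n n ℂ) := by
    rw [hK'def, hKdef]; abel
  -- (1) Peierls for the vector state
  have hsoft := softmin_le_expect hP hPh hPH hPB hH hB hβ e ψ hPψ hψ hHψ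
  rw [← hK'def] at hsoft
  have hBψ : (star ψ ⬝ᵥ (B *ᵥ ψ)).re = g * (star ψ ⬝ᵥ (A *ᵥ ψ)).re := by
    rw [hBdef, smul_mulVec, dotProduct_smul, smul_eq_mul, Complex.re_ofReal_mul]
  rw [hBψ] at hsoft
  -- positivity of the shifted sector partition function
  set Z' : ℝ := (P * gibbsWeight β K').trace.re with hZ'def
  have hZ'pos : 0 < Z' := sectorZ_pos_of_mem' hP hPh hPK' hK' β ψ hPψ hψ
  -- (2) Gibbs / log-sum in the sector
  have hA_stub := stub_sectorGibbsLogSum P K' hP hPh hK' β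
  rw [← hZ'def] at hA_stub
  -- split `Re tr (P W' K') = Re tr (P W' (H - e)) + Re tr (P W' B)`
  set W' : Matrix n n ℂ := gibbsWeight β K' with hW'def
  have hsplit : (P * W' * K').trace.re =
      (P * W' * (H - ((e : ℝ) : ℂ) • (1 : Matrix n n ℂ))).trace.re + (P * W' * B).trace.re := by
    rw [hK'def, Matrix.mul_add, trace_add, Complex.add_re]
  -- (3) the sector Gibbs state sits above `e`
  have hPW' : Commute P W' := by
    have : Commute P (-(β : ℂ) • K') := hPK'.smul_right _
    exact this.exp_right
  have hW'psd : W'.PosSemidef := (posDef_gibbsWeight β hK').posSemidef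
  have hB_stub := stub_sectorEnergyNonneg P W' H hP hPh hPW' hW'psd hH e he
  -- (4) the floor, transported to the shifted weight
  have hshift : W' = ((Real.exp (β * e) : ℝ) : ℂ) • gibbsWeight β K := by
    rw [hW'def, hKK']; exact gibbsWeight_sub_smul_one β e K
  have hZ'eq : Z' = Real.exp (β * e) * (P * gibbsWeight β K).trace.re := by
    rw [hZ'def, hshift, Matrix.mul_smul, trace_smul, smul_eq_mul, Complex.re_ofReal_mul]
  have hWB : (P * W' * B).trace.re =
      g * (Real.exp (β * e) * (P * gibbsWeight β K * A).trace.re) := by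
    rw [hshift, hBdef]
    simp only [Matrix.mul_smul, Matrix.smul_mul, trace_smul, smul_eq_mul, Complex.re_ofReal_mul]
  have hfloor' : g * (m * Z') ≤ (P * W' * B).trace.re := by
    rw [hWB, hZ'eq]
    refine mul_le_mul_of_nonneg_left ?_ hg
    have hexp : 0 ≤ Real.exp (β * e) := (Real.exp_pos _).le
    calc m * (Real.exp (β * e) * (P * gibbsWeight β K).trace.re)
        = Real.exp (β * e) * (m * (P * gibbsWeight β K).trace.re) := by ring
      _ ≤ Real.exp (β * e) * (P * gibbsWeight β K * A).trace.re :=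
          mul_le_mul_of_nonneg_left (by rw [hKdef, hBdef]; exact hfloor) hexp
  -- (5) combine: `Z' log Z' + β g m Z' ≤ Z' log d`, divide by `Z' > 0`
  have hmain : Z' * Real.log Z' + β * (g * (m * Z')) ≤ Z' * Real.log (P.trace.re) := by
    have : β * (g * (m * Z')) ≤ β * (P * W' * K').trace.re := by
      refine mul_le_mul_of_nonneg_left ?_ hβ.le
      rw [hsplit]; linarith
    linarith
  have hdiv : Real.log Z' + β * (g * m) ≤ Real.log (P.trace.re) := by
    have h1 : Z' * (Real.log Z' + β * (g * m)) ≤ Z' * Real.log (P.trace.re) := by nlinarith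
    exact le_of_mul_le_mul_left h1 hZ'pos
  -- `-(1/β) log Z' ≥ g m - log d / β`
  have hsm : g * m - Real.log (P.trace.re) / β ≤ -(1 / β) * Real.log Z' := by
    rw [show -(1 / β) * Real.log Z' = -(Real.log Z') / β by ring, sub_le_iff_le_add,
      show -Real.log Z' / β + Real.log (P.trace.re) / β = (Real.log (P.trace.re) - Real.log Z') / β
        by ring, le_div_iff₀ hβ]
    nlinarith
  exact hsm.trans hsoft
where
  /-- positivity of the sector partition function seen from a sector vector -/
  sectorZ_pos_of_mem' {P K : Matrix n n ℂ} (hP : P * P = P) (hPh : P.IsHermitian)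
      (hPK : Commute P K) (hK : K.IsHermitian) (β : ℝ) (ψ : n → ℂ) (hPψ : P *ᵥ ψ = ψ)
      (hψ : star ψ ⬝ᵥ ψ = 1) : 0 < (P * gibbsWeight β K).trace.re :=
    lt_of_lt_of_le (Real.exp_pos _) (sectorZ_ge_exp_quadForm hP hPh hPK hK β ψ hPψ hψ)

end Abstract

/-! ## §2 The Hubbard torus: every sector ground state inherits the penalised thermal floor -/

section Hubbard

/-- **Every sector ground state inherits the penalised thermal floor** (the lever at fixed
`(U, L)`). If the canonical `(2⌊(1-δ)L²/2⌋, S^z = 0)` Gibbs state at `β = θL²` of the penalised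
Hamiltonian `K = hubbardTorus 2 L 1 U + (κ/L⁴) Δ_d†Δ_d` has `⟨Δ_d†Δ_d⟩ ≥ x L⁴` (written with real
traces), `κ, x > 0` and `θκx ≥ 4 log 4`, then every normalised sector ground state `ψ` of
`hubbardTorus 2 L 1 U` has `(x/2) L⁴ ≤ Re ⟨ψ, Δ_d†Δ_d ψ⟩`. [folklore] -/
theorem everyGroundState_of_floorAt (L : ℕ) [NeZero L] (U δ κ x θ : ℝ)
    (hκ : 0 < κ) (hx : 0 < x) (hθ : 4 * Real.log 4 ≤ θ * κ * x)
    (hfloor :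
      x * (L : ℝ) ^ 4 *
          (projMatrix ((szSector (Λ := FermionTorus 2 L) (2 * ⌊(1 - δ) * (L : ℝ) ^ 2 / 2⌋₊) 0).map
              (Fock.toEuclidean (ι := Orb (FermionTorus 2 L)) :
                Fock (Orb (FermionTorus 2 L)) →ₗ[ℂ]
                  EuclideanSpace ℂ (Finset (Orb (FermionTorus 2 L))))) *
            gibbsWeight (θ * (L : ℝ) ^ 2) (hubbardTorus 2 L 1 U +
              ((κ / (L : ℝ) ^ 4 : ℝ) : ℂ) •
                ((pairField dWaveFormFactor L)ᴴ * pairField dWaveFormFactor L))).trace.re ≤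
        (projMatrix ((szSector (Λ := FermionTorus 2 L) (2 * ⌊(1 - δ) * (L : ℝ) ^ 2 / 2⌋₊) 0).map
              (Fock.toEuclidean (ι := Orb (FermionTorus 2 L)) :
                Fock (Orb (FermionTorus 2 L)) →ₗ[ℂ]
                  EuclideanSpace ℂ (Finset (Orb (FermionTorus 2 L))))) *
            gibbsWeight (θ * (L : ℝ) ^ 2) (hubbardTorus 2 L 1 U +
              ((κ / (L : ℝ) ^ 4 : ℝ) : ℂ) •
                ((pairField dWaveFormFactor L)ᴴ * pairField dWaveFormFactor L)) *
          ((pairField dWaveFormFactor L)ᴴ * pairField dWaveFormFactor L)).trace.re) :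
    ∀ ψ : Fock (Orb (FermionTorus 2 L)),
      IsGroundStateInSector (hubbardTorus 2 L 1 U) (2 * ⌊(1 - δ) * (L : ℝ) ^ 2 / 2⌋₊) 0 ψ →
      star ψ ⬝ᵥ ψ = 1 →
      x / 2 * (L : ℝ) ^ 4 ≤
        (star ψ ⬝ᵥ ((pairField dWaveFormFactor L)ᴴ * pairField dWaveFormFactor L) *ᵥ ψ).re := by
  intro ψ hgs h1
  -- notation
  set m : ℕ := ⌊(1 - δ) * (L : ℝ) ^ 2 / 2⌋₊ with hmdef
  set H := hubbardTorus 2 L 1 U with hHdef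
  set S := szSector (Λ := FermionTorus 2 L) (2 * m) 0 with hSdef
  set P := projMatrix (S.map (Fock.toEuclidean (ι := Orb (FermionTorus 2 L)) :
    Fock (Orb (FermionTorus 2 L)) →ₗ[ℂ] EuclideanSpace ℂ (Finset (Orb (FermionTorus 2 L)))))
    with hPdef
  set A := (pairField dWaveFormFactor L)ᴴ * pairField dWaveFormFactor L with hAdef
  set e : ℝ := H.minEnergyOn S with hedef
  have hL : (0 : ℝ) < (L : ℝ) := by exact_mod_cast Nat.pos_of_ne_zero (NeZero.ne L)
  have hL2 : (0 : ℝ) < (L : ℝ) ^ 2 := by positivity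
  have hL4 : (0 : ℝ) < (L : ℝ) ^ 4 := by positivity
  have hκx : 0 < κ * x := mul_pos hκ hx
  have hθpos : 0 < θ := by
    by_contra hθ0
    push Not at hθ0
    have : θ * κ * x ≤ 0 := by
      have := mul_nonpos_of_nonpos_of_nonneg (mul_nonpos_of_nonpos_of_nonneg hθ0 hκ.le) hx.le
      simpa [mul_assoc] using this
    have hlog4 : 0 < Real.log 4 := Real.log_pos (by norm_num)
    linarith
  have hβ : 0 < θ * (L : ℝ) ^ 2 := mul_pos hθpos hL2
  have hg : 0 ≤ κ / (L : ℝ) ^ 4 := (div_pos hκ hL4).le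
  -- structure of the sector projection
  have hH : H.IsHermitian := LiebThm1.hamiltonian_isHermitian (fermionTorusGraph 2 L) 1 U
  have hA : A.IsHermitian := Matrix.isHermitian_conjTranspose_mul_self _
  have hPh : P.IsHermitian := projMatrix_isHermitian _
  have hPP : P * P = P := projMatrix_mul_self _
  have hinv : ∀ v ∈ S, H *ᵥ v ∈ S := fun v hv => hubbardTorus_mulVec_mem_szSector 2 L 1 U m hv
  have hPH : Commute P H := projMatrix_map_commute_of_invariant hH S hinv
  have hPA : Commute P A := stub_sectorProjCommutePair L m
  -- the ground state
  obtain ⟨hψS, -, hHψ⟩ := hgs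
  have hPψ : P *ᵥ ψ = ψ := projMatrix_map_mulVec_of_mem S hψS
  have he : ∀ φ : Fock (Orb (FermionTorus 2 L)), P *ᵥ φ = φ → star φ ⬝ᵥ φ = 1 →
      e ≤ (star φ ⬝ᵥ (H *ᵥ φ)).re := by
    intro φ hPφ hφ1
    have hφS : φ ∈ S := by rw [← hPφ]; exact projMatrix_map_mulVec_mem S φ
    exact minEnergyOn_le_rayleigh_of_mem hH S hφS hφ1
  -- the abstract chain
  have hchain := softmin_chain P H A hPP hPh hPH hPA hH hA hβ hg (x * (L : ℝ) ^ 4) e he ψ hPψ h1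
    hHψ hfloor
  -- entropy budget
  have hlogP : Real.log (P.trace.re) ≤ (L : ℝ) ^ 2 * Real.log 4 := stub_logTraceSectorProjLe L _ _
  have hent : Real.log (P.trace.re) / (θ * (L : ℝ) ^ 2) ≤ Real.log 4 / θ := by
    rw [div_le_div_iff₀ hβ hθpos]
    calc Real.log (P.trace.re) * θ ≤ (L : ℝ) ^ 2 * Real.log 4 * θ :=
          mul_le_mul_of_nonneg_right hlogP hθpos.le
      _ = Real.log 4 * (θ * (L : ℝ) ^ 2) := by ring
  -- `log 4 / θ ≤ κ x / 4`
  have hbudget : Real.log 4 / θ ≤ κ * x / 4 := by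
    rw [div_le_div_iff₀ hθpos (by norm_num : (0:ℝ) < 4)]
    linarith
  -- arithmetic: `κ x - κ x/4 ≤ (κ/L⁴) ⟨A⟩`
  have hk : κ / (L : ℝ) ^ 4 * (x * (L : ℝ) ^ 4) = κ * x := by
    field_simp
  rw [hk] at hchain
  have hfinal : 3 / 4 * (κ * x) ≤ κ / (L : ℝ) ^ 4 * (star ψ ⬝ᵥ (A *ᵥ ψ)).re := by linarith
  -- divide by `κ / L⁴`
  have hq : x / 2 * (L : ℝ) ^ 4 ≤ 3 / 4 * x * (L : ℝ) ^ 4 := by nlinarith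
  refine hq.trans ?_
  have h3 : 3 / 4 * x * (L : ℝ) ^ 4 = (3 / 4 * (κ * x)) / (κ / (L : ℝ) ^ 4) := by
    field_simp
  rw [h3, div_le_iff₀ (div_pos hκ hL4)]
  linarith

/-- **Transfer (R1, tower schedule)**: the penalised thermal floor at `β_L = θL²` with
`θκx ≥ 4 log 4`, on a window of couplings and eventually in even `L`, implies the crux (with
constant `c = x/2`), via the every-ground-state bound and the landed glue
`birGroundStateAverageLRO_of_forall_groundState`. [folklore] -/
theorem stub_transferTower (δ U₁ U₂ κ x θ : ℝ) (hδ : δ ∈ Set.Ioo (0 : ℝ) (1 / 2)) (hU₁ : 0 < U₁)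
    (hU₁₂ : U₁ < U₂) (hκ : 0 < κ) (hx : 0 < x) (hθ : 4 * Real.log 4 ≤ θ * κ * x)
    (h : ∀ U ∈ Set.Ioo U₁ U₂, ∃ L₀ : ℕ, ∀ (L : ℕ) [NeZero L], L₀ ≤ L → Even L →
      let N : ℕ := 2 * ⌊(1 - δ) * (L : ℝ) ^ 2 / 2⌋₊
      let H := hubbardTorus 2 L 1 U
      let S := szSector (Λ := FermionTorus 2 L) N 0
      let P := projMatrix (S.map (Fock.toEuclidean (ι := Orb (FermionTorus 2 L)) :
        Fock (Orb (FermionTorus 2 L)) →ₗ[ℂ] EuclideanSpace ℂ (Finset (Orb (FermionTorus 2 L)))))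
      let A := (pairField dWaveFormFactor L)ᴴ * pairField dWaveFormFactor L
      let K := H + ((κ / (L : ℝ) ^ 4 : ℝ) : ℂ) • A
      let β : ℝ := θ * (L : ℝ) ^ 2
      x * (L : ℝ) ^ 4 * (P * gibbsWeight β K).trace.re ≤ (P * gibbsWeight β K * A).trace.re) :
    BirGroundStateAverageLRO := by
  refine birGroundStateAverageLRO_of_forall_groundState
    ⟨δ, hδ, U₁, U₂, x / 2, hU₁, hU₁₂, by positivity, fun U hU => ?_⟩
  obtain ⟨L₀, hL₀⟩ := h U hU
  refine ⟨L₀, fun L _ hL hLe => ?_⟩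
  exact everyGroundState_of_floorAt L U δ κ x θ hκ hx hθ (hL₀ L hL hLe)

/-- **Transfer (R1, tower schedule)** — alias of the registered stub `stub_transferTower` of line
`Sketch`: the penalised thermal floor at `β_L = θL²` with `θκx ≥ 4 log 4` on a window of couplings
implies `BirGroundStateAverageLRO` (constant `c = x/2`). [folklore] -/
theorem transfer_tower (δ U₁ U₂ κ x θ : ℝ) (hδ : δ ∈ Set.Ioo (0 : ℝ) (1 / 2)) (hU₁ : 0 < U₁)
    (hU₁₂ : U₁ < U₂) (hκ : 0 < κ) (hx : 0 < x) (hθ : 4 * Real.log 4 ≤ θ * κ * x)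
    (h : ∀ U ∈ Set.Ioo U₁ U₂, ∃ L₀ : ℕ, ∀ (L : ℕ) [NeZero L], L₀ ≤ L → Even L →
      let N : ℕ := 2 * ⌊(1 - δ) * (L : ℝ) ^ 2 / 2⌋₊
      let H := hubbardTorus 2 L 1 U
      let S := szSector (Λ := FermionTorus 2 L) N 0
      let P := projMatrix (S.map (Fock.toEuclidean (ι := Orb (FermionTorus 2 L)) :
        Fock (Orb (FermionTorus 2 L)) →ₗ[ℂ] EuclideanSpace ℂ (Finset (Orb (FermionTorus 2 L)))))
      let A := (pairField dWaveFormFactor L)ᴴ * pairField dWaveFormFactor L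
      let K := H + ((κ / (L : ℝ) ^ 4 : ℝ) : ℂ) • A
      let β : ℝ := θ * (L : ℝ) ^ 2
      x * (L : ℝ) ^ 4 * (P * gibbsWeight β K).trace.re ≤ (P * gibbsWeight β K * A).trace.re) :
    BirGroundStateAverageLRO :=
  stub_transferTower δ U₁ U₂ κ x θ hδ hU₁ hU₁₂ hκ hx hθ h

end Hubbard

end Summit.HubbardSuperconductivity.HubbardSuperconductivity.Theorems.BirGroundStateAverageLRO.Softmin
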